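import Mathlib
import HarnessLib
import Literature.Probability.MarkovChains.TotalVariation
import Summits.Ventures.LatticeQCDFlow.Exactness.TemperedTransitionsAcceptance
import Summits.Ventures.LatticeQCDFlow.Exactness.NCMCAcceptanceBounds
import Summits.Ventures.LatticeQCDFlow.Exactness.CrooksReversal
import Summits.Ventures.LatticeQCDFlow.Exactness.JarzynskiFinite
import Summits.Ventures.LatticeQCDFlow.Scaling.StochasticFlows
import Summits.Ventures.LatticeQCDFlow.Scaling.Bhattacharyya
import Summits.Ventures.LatticeQCDFlow.Scaling.SectorBudget

/-!
# Caps and floors of the tempered-transitions acceptance: half-work average and candidate law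

HONEST FRAMING: exact (Metropolis-corrected) sampling algorithms for lattice gauge theory;
figures of merit are autocorrelation/cost numbers at stated couplings and volumes; no
continuum-physics claim.

Venture `LatticeQCDFlow` (cell pub-lqcd), topic `Exactness`; FANOUT row 8 (`s0-cpn-nemc`, GEN-8).
NEW WORK of the cell (elementary finite sums), not a published result; nothing is cited as a fact.
Companion of `Exactness/TemperedTransitionsAcceptance.lean` (`acc_TT = 1 − ‖F − F∘swap‖_TV` for
Neal's round trip / palindromic NCMC, named only), in the pattern of
`Exactness/NCMCAcceptanceBounds.lean` for the one-way switch.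

## Content

* `ttAccRate_le_halfWork`, `bhatt_roundTrip_eq`, `one_sub_sqrt_le_ttAccRate` — the half-work
  average `B = ⟨e^{-W/2}⟩_F` is the Bhattacharyya coefficient of `F` and `F∘swap` and sandwiches the
  acceptance: `1 − √(1 − B²) ≤ acc_TT ≤ B` (termwise `min ≤ geometric mean`; Le Cam
  `Theory2.bhatt_sq_le`).
* `coarse_start_roundTripLaw` — the start marginal of the round-trip law is the target Gibbs law;
  **`ttAccRate_le_one_sub_tvDist_candidate`** — `acc_TT ≤ 1 − ‖π_0 − ν‖_TV`, `ν` the law of the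
  CANDIDATE end state `d 0` of a round trip started in equilibrium: the chain cannot accept more
  often than its raw candidates overlap the target (data processing `tvDist_coarse_le` along the
  start coordinate, whose image of `F∘swap` is `ν`).

The Pinsker floor of the one-way file has no verbatim analogue here: the round-trip law vanishes
on pairs not meeting at the top, and the tree's sharp Pinsker inequality is stated for positive
laws; the Le Cam floor above needs non-negativity only.
-/

namespace Summit.Ventures.LatticeQCDFlow.Exactness

open Finset
open Literature.Probability.MarkovChains
open Summit.Ventures.LatticeQCDFlow.Theory2 (gibbsLaw_pos sum_gibbsLaw partitionFn_pos coarse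
  bhatt bhatt_sq_le)

variable {X : Type*} [Fintype X] [DecidableEq X] {N : ℕ}

/-! ## The half-work (Bhattacharyya) sandwich -/

/-- `acc_TT ≤ ⟨e^{-W/2}⟩_F`: termwise `min(F, F e^{-W}) ≤ F e^{-W/2}`. -/
theorem ttAccRate_le_halfWork [Nonempty X] (S : Fin (N + 1) → X → ℝ) {T Tadj : Fin N → X → X → ℝ}
    (hT : ∀ i a b, 0 ≤ T i a b) (hTadj : ∀ i a b, 0 ≤ Tadj i a b)
    (hrev : ∀ i : Fin N, MutuallyReversible (fun x => Real.exp (-S i.succ x)) (T i) (Tadj i)) :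
    ttAccRate S T Tadj ≤
      ∑ z, roundTripLaw S T Tadj z * Real.exp (-(roundTripWork S z.1 z.2 / 2)) := by
  rw [ttAccRate_eq_sum_min S hT hTadj hrev]
  refine sum_le_sum fun z _ => ?_
  have hF := roundTripLaw_nonneg S hT hTadj z
  rw [roundTripLaw_swap S hrev z]
  set a := roundTripLaw S T Tadj z with ha
  set w := roundTripWork S z.1 z.2 with hw
  rcases le_or_gt 0 w with hw0 | hw0
  · calc min a (a * Real.exp (-w)) ≤ a * Real.exp (-w) := min_le_right _ _
      _ ≤ a * Real.exp (-(w / 2)) := mul_le_mul_of_nonneg_left (Real.exp_le_exp.mpr (by linarith)) hF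
  · calc min a (a * Real.exp (-w)) ≤ a := min_le_left _ _
      _ = a * 1 := (mul_one a).symm
      _ ≤ a * Real.exp (-(w / 2)) := mul_le_mul_of_nonneg_left (Real.one_le_exp (by linarith)) hF

/-- The half-work average is the Bhattacharyya coefficient of the round-trip law and its reversal. -/
theorem bhatt_roundTrip_eq [Nonempty X] (S : Fin (N + 1) → X → ℝ) {T Tadj : Fin N → X → X → ℝ}
    (hT : ∀ i a b, 0 ≤ T i a b) (hTadj : ∀ i a b, 0 ≤ Tadj i a b)
    (hrev : ∀ i : Fin N, MutuallyReversible (fun x => Real.exp (-S i.succ x)) (T i) (Tadj i)) :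
    bhatt (roundTripLaw S T Tadj) (fun z => roundTripLaw S T Tadj z.swap) =
      ∑ z, roundTripLaw S T Tadj z * Real.exp (-(roundTripWork S z.1 z.2 / 2)) := by
  unfold bhatt
  refine sum_congr rfl fun z _ => ?_
  have hF := roundTripLaw_nonneg S hT hTadj z
  simp only
  rw [roundTripLaw_swap S hrev z]
  set a := roundTripLaw S T Tadj z with ha
  set w := roundTripWork S z.1 z.2 with hw
  have hsq : a * (a * Real.exp (-w)) = (a * Real.exp (-(w / 2))) ^ 2 := by
    rw [mul_pow, pow_two (Real.exp _), ← Real.exp_add, show -(w / 2) + -(w / 2) = -w by ring]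
    ring
  rw [hsq, Real.sqrt_sq (mul_nonneg hF (Real.exp_pos _).le)]

/-- **Le Cam lower half:** `1 − √(1 − B²) ≤ acc_TT`, `B = ⟨e^{-W/2}⟩_F`; with
`ttAccRate_le_halfWork`, one recorded number brackets the acceptance in `[1 − √(1 − B²), B]`. -/
theorem one_sub_sqrt_le_ttAccRate [Nonempty X] (S : Fin (N + 1) → X → ℝ)
    {T Tadj : Fin N → X → X → ℝ} (hT : ∀ i a b, 0 ≤ T i a b) (hTadj : ∀ i a b, 0 ≤ Tadj i a b)
    (hTrow : ∀ i a, ∑ b, T i a b = 1) (hTadjrow : ∀ i b, ∑ a, Tadj i b a = 1)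
    (hrev : ∀ i : Fin N, MutuallyReversible (fun x => Real.exp (-S i.succ x)) (T i) (Tadj i)) :
    1 - Real.sqrt (1 - bhatt (roundTripLaw S T Tadj) (fun z => roundTripLaw S T Tadj z.swap) ^ 2)
      ≤ ttAccRate S T Tadj := by
  rw [ttAccRate_eq_one_sub_tvDist S hT hTadj hTrow hTadjrow hrev]
  have hle := bhatt_sq_le (roundTripLaw_nonneg S hT hTadj)
    (fun z => roundTripLaw_nonneg S hT hTadj z.swap)
    (sum_roundTripLaw S hTrow hTadjrow) (sum_roundTripLaw_swap S hTrow hTadjrow)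
  have htv : tvDist (roundTripLaw S T Tadj) (fun z => roundTripLaw S T Tadj z.swap) ≤
      Real.sqrt (1 - bhatt (roundTripLaw S T Tadj) (fun z => roundTripLaw S T Tadj z.swap) ^ 2) :=
    calc tvDist (roundTripLaw S T Tadj) (fun z => roundTripLaw S T Tadj z.swap)
        = Real.sqrt (tvDist (roundTripLaw S T Tadj) (fun z => roundTripLaw S T Tadj z.swap) ^ 2) :=
          (Real.sqrt_sq (tvDist_nonneg _ _)).symm
      _ ≤ _ := Real.sqrt_le_sqrt (by linarith)
  linarith

/-! ## The candidate law caps the acceptance -/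

/-- The START marginal of the round-trip law is the target Gibbs law (stochastic kernels). -/
theorem coarse_start_roundTripLaw [Nonempty X] (S : Fin (N + 1) → X → ℝ)
    {T Tadj : Fin N → X → X → ℝ}
    (hTrow : ∀ i a, ∑ b, T i a b = 1) (hTadjrow : ∀ i b, ∑ a, Tadj i b a = 1) :
    coarse (fun z : (Fin (N + 1) → X) × (Fin (N + 1) → X) => z.1 0) (roundTripLaw S T Tadj) =
      gibbsLaw (S 0) := by
  funext y
  unfold coarse
  rw [sum_filter, Fintype.sum_prod_type]
  simp only [roundTripLaw]
  -- inner sum over down-paths from the top of `u`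
  have hinner : ∀ u : Fin (N + 1) → X,
      ∑ d : Fin (N + 1) → X, (if u 0 = y then
        (if u (Fin.last N) = d (Fin.last N) then
          gibbsLaw (S 0) (u 0) * upProb T u * downProb Tadj d else 0) else 0) =
      (if u 0 = y then gibbsLaw (S 0) (u 0) else 0) * transProb T u := by
    intro u
    have h := sum_terminal_downProb (fun x => if u (Fin.last N) = x then (1 : ℝ) else 0) Tadj hTadjrow
    rw [sum_ite_eq univ (u (Fin.last N)), if_pos (mem_univ _)] at h
    by_cases hu : u 0 = y
    · simp only [if_pos hu]
      calc ∑ d : Fin (N + 1) → X, (if u (Fin.last N) = d (Fin.last N) then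
              gibbsLaw (S 0) (u 0) * upProb T u * downProb Tadj d else 0)
          = ∑ d : Fin (N + 1) → X, gibbsLaw (S 0) (u 0) * upProb T u *
              ((if u (Fin.last N) = d (Fin.last N) then (1 : ℝ) else 0) * downProb Tadj d) := by
            refine sum_congr rfl fun d _ => ?_
            split_ifs <;> ring
        _ = gibbsLaw (S 0) (u 0) * transProb T u := by
            rw [← mul_sum, h, mul_one]; rfl
    · simp only [if_neg hu, zero_mul, sum_const_zero]
  simp only [hinner]
  have h2 := sum_pathLaw (fun x => if x = y then gibbsLaw (S 0) x else 0) T hTrow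
  simp only [pathLaw] at h2
  rw [h2, sum_ite_eq' univ y, if_pos (mem_univ _)]

/-- **THE CANDIDATE-LAW CAP.**  `acc_TT ≤ 1 − ‖π_0 − ν‖_TV`, where `π_0 = e^{-S 0}/Z 0` is the
target and `ν = coarse (z ↦ z.2 0) F` the law of the CANDIDATE end state `d 0` of a round trip
started in equilibrium (data processing of `ttAccRate_eq_one_sub_tvDist` along `z ↦ z.1 0`, whose
image of `F∘swap` is `ν`). -/
theorem ttAccRate_le_one_sub_tvDist_candidate [Nonempty X] (S : Fin (N + 1) → X → ℝ)
    {T Tadj : Fin N → X → X → ℝ} (hT : ∀ i a b, 0 ≤ T i a b) (hTadj : ∀ i a b, 0 ≤ Tadj i a b)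
    (hTrow : ∀ i a, ∑ b, T i a b = 1) (hTadjrow : ∀ i b, ∑ a, Tadj i b a = 1)
    (hrev : ∀ i : Fin N, MutuallyReversible (fun x => Real.exp (-S i.succ x)) (T i) (Tadj i)) :
    ttAccRate S T Tadj ≤ 1 - tvDist (gibbsLaw (S 0))
      (coarse (fun z : (Fin (N + 1) → X) × (Fin (N + 1) → X) => z.2 0) (roundTripLaw S T Tadj)) := by
  rw [ttAccRate_eq_one_sub_tvDist S hT hTadj hTrow hTadjrow hrev]
  have hdp := tvDist_coarse_le (fun z : (Fin (N + 1) → X) × (Fin (N + 1) → X) => z.1 0)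
    (roundTripLaw S T Tadj) (fun z => roundTripLaw S T Tadj z.swap)
  rw [coarse_start_roundTripLaw S hTrow hTadjrow] at hdp
  have hsw : coarse (fun z : (Fin (N + 1) → X) × (Fin (N + 1) → X) => z.1 0)
      (fun z => roundTripLaw S T Tadj z.swap) =
      coarse (fun z : (Fin (N + 1) → X) × (Fin (N + 1) → X) => z.2 0) (roundTripLaw S T Tadj) := by
    funext y
    unfold coarse
    rw [sum_filter, sum_filter]
    exact Fintype.sum_equiv (Equiv.prodComm _ _) _ _ (fun z => rfl)
  rw [hsw] at hdp
  linarith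

end Summit.Ventures.LatticeQCDFlow.Exactness
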